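import Summits.ResolutionOfSingularities.ResolutionOfSingularities.Theorems.EquisingularLiftEquisingularLiftNatTwoStepLocality
import HarnessLib

/-!
# [OURS] THE ONE-BLOW-UP STEP WITH AN ARBITRARY LOCAL PAYLOAD IS LOCAL ON THE BASE (`iff`) — the induction step of LOCALITY for every blow-up tower
# (cruxes `Theses.EquisingularLift.EquisingularLiftNat` / `…NatThree`, stmt-ResolutionOfSingularities-20038 / -20148)

[OURS · leafhand-res-equisingularlift-10 g1, 2026-08-31; cell `pub/decomp-res`] AI-produced, weaker than expert review; NOT a statement of any manuscript;
nothing here proves resolution of singularities in positive characteristic.  DEF-FREE helper; no `sorry`; standard axioms; ZERO named hypotheses.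

The depth-graded descent ✓ `PointChain.chain_of_finiteDepthPoints` (p831131) needs its point-property LOCAL in `iff` form.  For the intrinsic blow-up tower
(level `d + 1` at `y` := «every blow-up at the reduced point `y` is regular over `y` except at finitely many closed points of levels `≤ d`») locality is
proved level by level; this file is THE INDUCTION STEP, once and for all, for an ARBITRARY payload `E : Π Z, Z → Prop` that is itself local (`hE`):

  `Step_E Γ y` := for every blow-up `τ : Z → Γ` at the reduced closed point `y` there is a finite `S' ⊆ Z` with `Z` regular over `y` off `S'` and every
  `z ∈ S'` over `y`, closed, with `E Z z`.

* ★★★ `PointChain.stepAt_of_isIso_morphismRestrict` — `ρ : Γ₂ → Γ` an isomorphism over an open `U ∋ y`, closed `y₂ ↦ y`: `Step_E Γ y ⟹ Step_E Γ₂ y₂`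
  (the proof of ✓ `twoStepAt_of_isIso_morphismRestrict` with the payload moved by `hE` along `B ⊇ π_B⁻¹U ≅ τ⁻¹(ρ⁻¹U) ⊆ Z`);
* ★ `PointChain.stepAt_of_open` — `Step_E` passes from an open `W ∋ y` to the ambient scheme;
* ★★ `PointChain.stepAt_iff_of_isIso_morphismRestrict` — **the `iff` form** (`←` through `Γ₂ ⊇ ρ⁻¹U ≅ U ⊆ Γ`).

With `E :=` one-step these are ✓ `twoStepAt_of_isIso_morphismRestrict` / ✓ `twoStepAt_of_open` / ✓ `twoStepAt_iff_of_isIso_morphismRestrict` again.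
Honest label: closes no registered stub.

References: [GortzWedhorn2020, Prop. 13.91, (13.19)]; [StacksProject, Tags 080E, 02OS] — through the cited tree files.
-/

set_option linter.dupNamespace false -- mandated namespace `Summit.<Summit>.<Problem>` of this single-conjunct summit

noncomputable section

open CategoryTheory CategoryTheory.Limits AlgebraicGeometry TopologicalSpace
open Literature.AlgebraicGeometry.Resolution
open AlgebraicGeometry.Scheme.IdealSheafData

namespace Summit.ResolutionOfSingularities.ResolutionOfSingularities.Cruxes.EquisingularLiftNat.Sections

namespace PointChain

universe u

/-- ★★★ **THE ONE-BLOW-UP STEP WITH A LOCAL PAYLOAD IS LOCAL ON THE BASE.**  `E` a point-property local in `iff` form (`hE`); `ρ : Γ₂ → Γ` an isomorphism over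
an open `U ∋ y` (`y` closed), `y₂` a closed point over `y`.  If every blow-up `B → Γ` at the reduced point `y` is regular over `y` off a finite set of closed
`E`-points over `y`, then the same holds for every blow-up `Z → Γ₂` at `y₂`: over `ρ⁻¹U ≅ U` both are blow-ups of `U` at its point over `y`, unique up to
isomorphism (✓ `IsBlowup.restrict`, ✓ `IsBlowup.unique`); the finite set is carried through, closedness by ✓ `isClosed_singleton_of_preimage`, the payload by
`hE` three times. [OURS] [cite: GortzWedhorn2020, Prop. 13.91, (13.19)] -/
theorem stepAt_of_isIso_morphismRestrict (E : ∀ Z : Scheme.{u}, Z → Prop)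
    (hE : ∀ (Z Z₂ : Scheme.{u}) (ρ : Z₂ ⟶ Z) (U : Z.Opens), IsIso (ρ ∣_ U) → ∀ z : Z, z ∈ U → IsClosed ({z} : Set Z) →
      ∀ z₂ : Z₂, ρ z₂ = z → IsClosed ({z₂} : Set Z₂) → (E Z z ↔ E Z₂ z₂))
    {Γ Γ₂ : Scheme.{u}} (ρ : Γ₂ ⟶ Γ) (U : Γ.Opens) [IsIso (ρ ∣_ U)]
    {y : Γ} (hyU : y ∈ U) (hy : IsClosed ({y} : Set Γ))
    (hstep : ∀ (B : Scheme.{u}) (π : B ⟶ Γ), IsBlowup π (vanishingIdeal ⟨{y}, hy⟩) →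
      ∃ S' : Finset B, (∀ b : B, π b = y → b ∉ S' → IsRegularLocalRing (B.presheaf.stalk b)) ∧
        ∀ b ∈ S', π b = y ∧ IsClosed ({b} : Set B) ∧ E B b)
    {y₂ : Γ₂} (hy₂ : ρ y₂ = y) (hy₂cl : IsClosed ({y₂} : Set Γ₂)) :
    ∀ (Z : Scheme.{u}) (τ : Z ⟶ Γ₂), IsBlowup τ (vanishingIdeal ⟨{y₂}, hy₂cl⟩) →
      ∃ S' : Finset Z, (∀ z : Z, τ z = y₂ → z ∉ S' → IsRegularLocalRing (Z.presheaf.stalk z)) ∧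
        ∀ z ∈ S', τ z = y₂ ∧ IsClosed ({z} : Set Z) ∧ E Z z := by
  classical
  intro Z τ hτ
  -- the open `V = ρ⁻¹ U ∋ y₂` and the isomorphism `e : V ≅ U`
  set V : Γ₂.Opens := ρ ⁻¹ᵁ U with hV
  have hy₂V : y₂ ∈ V := by change ρ y₂ ∈ U; rw [hy₂]; exact hyU
  let e : (V : Scheme.{u}) ≅ (U : Scheme.{u}) := asIso (ρ ∣_ U)
  obtain ⟨u₀, hu₀⟩ : ∃ u₀ : (U : Scheme.{u}), U.ι u₀ = y := ⟨⟨y, hyU⟩, rfl⟩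
  obtain ⟨v₀, hv₀⟩ : ∃ v₀ : (V : Scheme.{u}), V.ι v₀ = y₂ := ⟨⟨y₂, hy₂V⟩, rfl⟩
  have hu₀cl := isClosed_singleton_of_openι_eq U hy u₀ hu₀
  have hv₀cl := isClosed_singleton_of_openι_eq V hy₂cl v₀ hv₀
  have hev : e.hom v₀ = u₀ := by
    apply U.ι.isOpenEmbedding.injective
    rw [hu₀, ← Scheme.Hom.comp_apply]
    change ((ρ ∣_ U) ≫ U.ι) v₀ = y; rw [morphismRestrict_ι, Scheme.Hom.comp_apply, hv₀, hy₂]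
  -- `τ` restricted over `V`, then moved to `U`: a blow-up of `U` at `u₀`
  have hτV : IsBlowup (τ ∣_ V) (vanishingIdeal ⟨{v₀}, hv₀cl⟩) := by
    have h := hτ.restrict V
    rwa [comap_vanishingIdeal_singleton_openι V hy₂cl v₀ hv₀ hv₀cl] at h
  have hey : IsClosed ({e.hom v₀} : Set (U : Scheme.{u})) := by rw [hev]; exact hu₀cl
  have hτU : IsBlowup (τ ∣_ V ≫ e.hom) (vanishingIdeal ⟨{e.hom v₀}, hey⟩) :=
    isBlowup_comp_iso_vanishingIdeal_singleton hv₀cl hτV e hey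
  have hC : (⟨{e.hom v₀}, hey⟩ : Closeds (U : Scheme.{u})) = ⟨{u₀}, hu₀cl⟩ := Closeds.ext (by
    change ({e.hom v₀} : Set (U : Scheme.{u})) = {u₀}
    rw [hev])
  rw [hC] at hτU
  -- the reference blow-up `B → Γ` at `y`, restricted over `U`
  obtain ⟨B, πB, hπB⟩ : ∃ (B : Scheme.{u}) (πB : B ⟶ Γ), IsBlowup πB (vanishingIdeal ⟨{y}, hy⟩) :=
    ⟨_, _, blowup.isBlowup (vanishingIdeal (⟨{y}, hy⟩ : Closeds Γ))⟩
  have hπBU : IsBlowup (πB ∣_ U) (vanishingIdeal ⟨{u₀}, hu₀cl⟩) := by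
    have h := hπB.restrict U
    rwa [comap_vanishingIdeal_singleton_openι U hy u₀ hu₀ hu₀cl] at h
  -- uniqueness of blow-ups: `τ⁻¹ V ≅ πB⁻¹ U` over `U`
  obtain ⟨e₂, he₂, he₂'⟩ := hτU.unique hπBU
  haveI : IsIso (e₂.hom ∣_ (⊤ : (πB ⁻¹ᵁ U : Scheme.{u}).Opens)) := inferInstance
  haveI := isIso_ι_morphismRestrict_self (πB ⁻¹ᵁ U)
  haveI := isIso_ι_morphismRestrict_self (τ ⁻¹ᵁ V)
  -- the step datum of the reference blow-up
  obtain ⟨SB, hregB, hSB⟩ := hstep B πB hπB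
  -- dictionary between points of `Z` over `y₂` and points of `B` over `y`
  have hWB : ∀ b : B, πB b = y → b ∈ πB ⁻¹ᵁ U := fun b hb => by change πB b ∈ U; rw [hb]; exact hyU
  -- transport of a point `b ∈ SB` to `Z`
  let tr : {b // b ∈ SB} → Z := fun b => (τ ⁻¹ᵁ V).ι (e₂.inv ⟨b.1, hWB b.1 (hSB b.1 b.2).1⟩)
  let S' : Finset Z := SB.attach.image tr
  -- a point `z` over `y₂`: its avatar in `τ⁻¹ V` and its image `b` in `B`
  have havatar : ∀ z : Z, τ z = y₂ → ∃ zV : (τ ⁻¹ᵁ V : Scheme.{u}), (τ ⁻¹ᵁ V).ι zV = z ∧ (τ ∣_ V) zV = v₀ := by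
    intro z hz
    have hzV : z ∈ τ ⁻¹ᵁ V := by change τ z ∈ V; rw [hz]; exact hy₂V
    refine ⟨⟨z, hzV⟩, rfl, ?_⟩
    apply V.ι.isOpenEmbedding.injective
    rw [hv₀, ← Scheme.Hom.comp_apply, morphismRestrict_ι, Scheme.Hom.comp_apply]
    exact hz
  have hb_of : ∀ zV : (τ ⁻¹ᵁ V : Scheme.{u}), (τ ∣_ V) zV = v₀ → πB ((πB ⁻¹ᵁ U).ι (e₂.hom zV)) = y := by
    intro zV hzV
    rw [← Scheme.Hom.comp_apply, ← morphismRestrict_ι, Scheme.Hom.comp_apply, ← Scheme.Hom.comp_apply e₂.hom, he₂,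
      Scheme.Hom.comp_apply, hzV, hev, hu₀]
  refine ⟨S', fun z hz hzS => ?_, fun z hz => ?_⟩
  · -- (a) regular off `S'`
    obtain ⟨zV, hzV', hτzV⟩ := havatar z hz
    set b : B := (πB ⁻¹ᵁ U).ι (e₂.hom zV) with hbdef
    have hb : πB b = y := hb_of zV hτzV
    have hbSB : b ∉ SB := by
      intro hbSB
      apply hzS
      refine Finset.mem_image.mpr ⟨⟨b, hbSB⟩, Finset.mem_attach _ _, ?_⟩
      change (τ ⁻¹ᵁ V).ι (e₂.inv ⟨b, _⟩) = z
      have hbU : (⟨b, hWB b (hSB b hbSB).1⟩ : (πB ⁻¹ᵁ U : Scheme.{u})) = e₂.hom zV := by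
        apply (πB ⁻¹ᵁ U).ι.isOpenEmbedding.injective
        rw [Scheme.Opens.ι_apply, ← hbdef]
      rw [hbU]
      have hinv : e₂.inv (e₂.hom zV) = zV := by
        change (e₂.hom ≫ e₂.inv) zV = zV
        rw [e₂.hom_inv_id]; rfl
      rw [hinv]
      exact hzV'
    haveI hBreg : IsRegularLocalRing (B.presheaf.stalk b) := hregB b hb hbSB
    haveI : IsRegularLocalRing ((πB ⁻¹ᵁ U : Scheme.{u}).presheaf.stalk (e₂.hom zV)) :=
      IsRegularLocalRing.of_ringEquiv (R := B.presheaf.stalk b) (asIso (((πB ⁻¹ᵁ U).ι).stalkMap (e₂.hom zV))).commRingCatIsoToRingEquiv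
    haveI : IsRegularLocalRing ((τ ⁻¹ᵁ V : Scheme.{u}).presheaf.stalk zV) :=
      IsRegularLocalRing.of_ringEquiv (R := (πB ⁻¹ᵁ U : Scheme.{u}).presheaf.stalk (e₂.hom zV))
        (asIso (e₂.hom.stalkMap zV)).commRingCatIsoToRingEquiv
    rw [← hzV']
    exact IsRegularLocalRing.of_ringEquiv (R := (τ ⁻¹ᵁ V : Scheme.{u}).presheaf.stalk zV)
      (asIso (((τ ⁻¹ᵁ V).ι).stalkMap zV)).commRingCatIsoToRingEquiv.symm
  · -- (b) the points of `S'`: over `y₂`, closed, `E`-points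
    obtain ⟨b, -, rfl⟩ := Finset.mem_image.mp hz
    obtain ⟨hby, hbcl, hEb⟩ := hSB b.1 b.2
    set bU : (πB ⁻¹ᵁ U : Scheme.{u}) := ⟨b.1, hWB b.1 hby⟩ with hbUdef
    have hbU : (πB ⁻¹ᵁ U).ι bU = b.1 := rfl
    set zV : (τ ⁻¹ᵁ V : Scheme.{u}) := e₂.inv bU with hzVdef
    have hezV : e₂.hom zV = bU := by
      rw [hzVdef, ← Scheme.Hom.comp_apply, e₂.inv_hom_id]; rfl
    -- over `y₂`
    have hτzV : (τ ∣_ V) zV = v₀ := by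
      apply (Scheme.homeoOfIso e).injective
      change e.hom ((τ ∣_ V) zV) = e.hom v₀
      rw [hev, ← Scheme.Hom.comp_apply, ← he₂, Scheme.Hom.comp_apply, hezV]
      apply U.ι.isOpenEmbedding.injective
      rw [hu₀, ← Scheme.Hom.comp_apply, morphismRestrict_ι, Scheme.Hom.comp_apply, hbU, hby]
    have hτz : τ ((τ ⁻¹ᵁ V).ι zV) = y₂ := by
      rw [← Scheme.Hom.comp_apply, ← morphismRestrict_ι, Scheme.Hom.comp_apply, hτzV, hv₀]
    -- closed
    have hbUcl : IsClosed ({bU} : Set (πB ⁻¹ᵁ U : Scheme.{u})) := isClosed_singleton_of_openι_eq (πB ⁻¹ᵁ U) hbcl bU hbU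
    have hzVcl : IsClosed ({zV} : Set (τ ⁻¹ᵁ V : Scheme.{u})) :=
      isClosed_singleton_of_injective e₂.hom (Scheme.homeoOfIso e₂).injective (by rw [hezV]; exact hbUcl)
    have hzV_mem : τ ((τ ⁻¹ᵁ V).ι zV) ∈ V := by rw [hτz]; exact hy₂V
    have hzcl : IsClosed ({(τ ⁻¹ᵁ V).ι zV} : Set Z) :=
      isClosed_singleton_of_preimage τ V (by rw [hτz]; exact hy₂cl) hzV_mem zV rfl hzVcl
    refine ⟨hτz, hzcl, ?_⟩
    -- the payload: `b` in `B` ⟹ `bU` in `πB⁻¹U` ⟹ `zV` in `τ⁻¹V` ⟹ `z` in `Z`, by `hE` three times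
    have h1 : E (πB ⁻¹ᵁ U : Scheme.{u}) bU :=
      (hE B (πB ⁻¹ᵁ U) (πB ⁻¹ᵁ U).ι (πB ⁻¹ᵁ U) inferInstance b.1 (hWB b.1 hby) hbcl bU hbU hbUcl).mp hEb
    have h2 : E (τ ⁻¹ᵁ V : Scheme.{u}) zV :=
      (hE (πB ⁻¹ᵁ U) (τ ⁻¹ᵁ V) e₂.hom ⊤ inferInstance bU (Set.mem_univ bU) hbUcl zV hezV hzVcl).mp h1
    exact (hE Z (τ ⁻¹ᵁ V) (τ ⁻¹ᵁ V).ι (τ ⁻¹ᵁ V) inferInstance ((τ ⁻¹ᵁ V).ι zV) hzV_mem hzcl zV rfl hzVcl).mpr h2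

/-- ★ **The step with a local payload passes from an open to the ambient scheme**: if every blow-up of the open `W ∋ y` at its point `w₀` over the closed
point `y` is regular over `w₀` off finitely many closed `E`-points, then so is every blow-up of `Γ` at `y` (restrict over `W`: ✓ `IsBlowup.restrict`; push the
finite set forward along `(τ⁻¹W).ι`, the payload by `hE`). [folklore] [cite: GortzWedhorn2020, Prop. 13.91] -/
theorem stepAt_of_open (E : ∀ Z : Scheme.{u}, Z → Prop)
    (hE : ∀ (Z Z₂ : Scheme.{u}) (ρ : Z₂ ⟶ Z) (U : Z.Opens), IsIso (ρ ∣_ U) → ∀ z : Z, z ∈ U → IsClosed ({z} : Set Z) →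
      ∀ z₂ : Z₂, ρ z₂ = z → IsClosed ({z₂} : Set Z₂) → (E Z z ↔ E Z₂ z₂))
    {Γ : Scheme.{u}} (W : Γ.Opens) {y : Γ} (hyW : y ∈ W) (hy : IsClosed ({y} : Set Γ))
    (w₀ : (W : Scheme.{u})) (hw₀ : W.ι w₀ = y) (hw₀cl : IsClosed ({w₀} : Set (W : Scheme.{u})))
    (hstep : ∀ (B : Scheme.{u}) (π : B ⟶ W), IsBlowup π (vanishingIdeal ⟨{w₀}, hw₀cl⟩) →
      ∃ S' : Finset B, (∀ b : B, π b = w₀ → b ∉ S' → IsRegularLocalRing (B.presheaf.stalk b)) ∧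
        ∀ b ∈ S', π b = w₀ ∧ IsClosed ({b} : Set B) ∧ E B b) :
    ∀ (Z : Scheme.{u}) (τ : Z ⟶ Γ), IsBlowup τ (vanishingIdeal ⟨{y}, hy⟩) →
      ∃ S' : Finset Z, (∀ z : Z, τ z = y → z ∉ S' → IsRegularLocalRing (Z.presheaf.stalk z)) ∧
        ∀ z ∈ S', τ z = y ∧ IsClosed ({z} : Set Z) ∧ E Z z := by
  classical
  intro Z τ hτ
  have hτW : IsBlowup (τ ∣_ W) (vanishingIdeal ⟨{w₀}, hw₀cl⟩) := by
    have h := hτ.restrict W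
    rwa [comap_vanishingIdeal_singleton_openι W hy w₀ hw₀ hw₀cl] at h
  obtain ⟨SW, hregW, hSW⟩ := hstep _ (τ ∣_ W) hτW
  haveI := isIso_ι_morphismRestrict_self (τ ⁻¹ᵁ W)
  let S' : Finset Z := SW.image (τ ⁻¹ᵁ W).ι
  have havatar : ∀ z : Z, τ z = y → ∃ zW : (τ ⁻¹ᵁ W : Scheme.{u}), (τ ⁻¹ᵁ W).ι zW = z ∧ (τ ∣_ W) zW = w₀ := by
    intro z hz
    have hzW : z ∈ τ ⁻¹ᵁ W := by change τ z ∈ W; rw [hz]; exact hyW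
    refine ⟨⟨z, hzW⟩, rfl, ?_⟩
    apply W.ι.isOpenEmbedding.injective
    rw [hw₀, ← Scheme.Hom.comp_apply, morphismRestrict_ι, Scheme.Hom.comp_apply]
    exact hz
  refine ⟨S', fun z hz hzS => ?_, fun z hz => ?_⟩
  · obtain ⟨zW, hzW', hτzW⟩ := havatar z hz
    have hzWS : zW ∉ SW := fun h => hzS (Finset.mem_image.mpr ⟨zW, h, hzW'⟩)
    haveI := hregW zW hτzW hzWS
    rw [← hzW']
    exact IsRegularLocalRing.of_ringEquiv (R := (τ ⁻¹ᵁ W : Scheme.{u}).presheaf.stalk zW)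
      (asIso (((τ ⁻¹ᵁ W).ι).stalkMap zW)).commRingCatIsoToRingEquiv.symm
  · obtain ⟨zW, hzWS, rfl⟩ := Finset.mem_image.mp hz
    obtain ⟨hτzW, hzWcl, hEz⟩ := hSW zW hzWS
    have hτz : τ ((τ ⁻¹ᵁ W).ι zW) = y := by
      rw [← Scheme.Hom.comp_apply, ← morphismRestrict_ι, Scheme.Hom.comp_apply, hτzW, hw₀]
    have hzW_mem : τ ((τ ⁻¹ᵁ W).ι zW) ∈ W := by rw [hτz]; exact hyW
    have hzcl : IsClosed ({(τ ⁻¹ᵁ W).ι zW} : Set Z) :=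
      isClosed_singleton_of_preimage τ W (by rw [hτz]; exact hy) hzW_mem zW rfl hzWcl
    exact ⟨hτz, hzcl, (hE Z (τ ⁻¹ᵁ W) (τ ⁻¹ᵁ W).ι (τ ⁻¹ᵁ W) inferInstance ((τ ⁻¹ᵁ W).ι zW) hzW_mem hzcl zW rfl hzWcl).mpr hEz⟩

/-- ★★ **THE STEP WITH A LOCAL PAYLOAD IS LOCAL ON THE BASE, `iff` form.**  `ρ : Γ₂ → Γ` an isomorphism over an open `U ∋ y`, `y` and `y₂ ↦ y` closed:
`Step_E Γ y ↔ Step_E Γ₂ y₂` (`→` `stepAt_of_isIso_morphismRestrict`; `←` through `Γ₂ ⊇ ρ⁻¹U ≅ U ⊆ Γ`: to the open along `(ρ⁻¹U).ι`, across the isomorphism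
along its inverse, down by `stepAt_of_open`). [OURS] [cite: GortzWedhorn2020, Prop. 13.91, (13.19)] -/
theorem stepAt_iff_of_isIso_morphismRestrict (E : ∀ Z : Scheme.{u}, Z → Prop)
    (hE : ∀ (Z Z₂ : Scheme.{u}) (ρ : Z₂ ⟶ Z) (U : Z.Opens), IsIso (ρ ∣_ U) → ∀ z : Z, z ∈ U → IsClosed ({z} : Set Z) →
      ∀ z₂ : Z₂, ρ z₂ = z → IsClosed ({z₂} : Set Z₂) → (E Z z ↔ E Z₂ z₂))
    {Γ Γ₂ : Scheme.{u}} (ρ : Γ₂ ⟶ Γ) (U : Γ.Opens) [IsIso (ρ ∣_ U)]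
    {y : Γ} (hyU : y ∈ U) (hy : IsClosed ({y} : Set Γ)) {y₂ : Γ₂} (hy₂ : ρ y₂ = y) (hy₂cl : IsClosed ({y₂} : Set Γ₂)) :
    (∀ (B : Scheme.{u}) (π : B ⟶ Γ), IsBlowup π (vanishingIdeal ⟨{y}, hy⟩) →
      ∃ S' : Finset B, (∀ b : B, π b = y → b ∉ S' → IsRegularLocalRing (B.presheaf.stalk b)) ∧
        ∀ b ∈ S', π b = y ∧ IsClosed ({b} : Set B) ∧ E B b) ↔
    (∀ (Z : Scheme.{u}) (τ : Z ⟶ Γ₂), IsBlowup τ (vanishingIdeal ⟨{y₂}, hy₂cl⟩) →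
      ∃ S' : Finset Z, (∀ z : Z, τ z = y₂ → z ∉ S' → IsRegularLocalRing (Z.presheaf.stalk z)) ∧
        ∀ z ∈ S', τ z = y₂ ∧ IsClosed ({z} : Set Z) ∧ E Z z) := by
  refine ⟨fun h => stepAt_of_isIso_morphismRestrict E hE ρ U hyU hy h hy₂ hy₂cl, fun h₂ => ?_⟩
  -- the open `V = ρ⁻¹ U ∋ y₂` and the isomorphism `e : V ≅ U`
  set V : Γ₂.Opens := ρ ⁻¹ᵁ U with hV
  have hy₂V : y₂ ∈ V := by change ρ y₂ ∈ U; rw [hy₂]; exact hyU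
  let e : (V : Scheme.{u}) ≅ (U : Scheme.{u}) := asIso (ρ ∣_ U)
  obtain ⟨u₀, hu₀⟩ : ∃ u₀ : (U : Scheme.{u}), U.ι u₀ = y := ⟨⟨y, hyU⟩, rfl⟩
  obtain ⟨v₀, hv₀⟩ : ∃ v₀ : (V : Scheme.{u}), V.ι v₀ = y₂ := ⟨⟨y₂, hy₂V⟩, rfl⟩
  have hev : e.hom v₀ = u₀ := by
    apply U.ι.isOpenEmbedding.injective
    rw [hu₀, ← Scheme.Hom.comp_apply]
    change ((ρ ∣_ U) ≫ U.ι) v₀ = y; rw [morphismRestrict_ι, Scheme.Hom.comp_apply, hv₀, hy₂]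
  subst hev
  have hu₀cl := isClosed_singleton_of_openι_eq U hy (e.hom v₀) hu₀
  have hv₀cl := isClosed_singleton_of_openι_eq V hy₂cl v₀ hv₀
  have hve : e.inv (e.hom v₀) = v₀ := by
    change (e.hom ≫ e.inv) v₀ = v₀
    rw [e.hom_inv_id]; rfl
  -- `y₂` ⟹ `v₀` (to the open `V`) ⟹ `e v₀` (across `e`, i.e. along `e⁻¹`) ⟹ `y` (down from the open `U`)
  haveI := isIso_ι_morphismRestrict_self V
  haveI : IsIso (e.inv ∣_ (⊤ : (V : Scheme.{u}).Opens)) := inferInstance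
  have h1 := stepAt_of_isIso_morphismRestrict E hE V.ι V hy₂V hy₂cl h₂ hv₀ hv₀cl
  have h2 := stepAt_of_isIso_morphismRestrict E hE e.inv ⊤ (Set.mem_univ v₀) hv₀cl h1 hve hu₀cl
  exact stepAt_of_open E hE U hyU hy (e.hom v₀) hu₀ hu₀cl h2

end PointChain

end Summit.ResolutionOfSingularities.ResolutionOfSingularities.Cruxes.EquisingularLiftNat.Sections

end
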